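import Summits.QuantumFields.YangMills.Theorems.DoublingDefectRecursionToGapIteration
import Summits.QuantumFields.YangMills.Theorems.DoublingDefectRecursionToGapSpectral
import Summits.QuantumFields.YangMills.Theorems.PencilRigidityWeakCouplingHypercubicLimitColdPressureClustering
import HarnessLib

/-!
# `RecursionToGap` with the cold period-doubling defect — the repaired glue of route `DoublingDefect`, PROVED

Item `RecursionToGap` (stmt-QuantumFields-17755, support of route `DoublingDefect`, `QuantumFields/YangMills`) asks:
for simply-connected compact simple `G` and faithful unitary `r`, the DOUBLING RECURSION `δ_β(L') ≤ C δ_β(L)²`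
(`L' ∈ [2L, 4L]`) and the ONE-TORUS EXIT (`δ_β(L) ≤ ε` at arbitrarily large `L`) for the period-doubling (purity)
defect of Wilson's theory imply the volume-uniform weak-coupling lattice gap (the `UniformLatticeGap` body for
`(G, r)`).  As filed the defect is that of the aspect-`(1, 2)` pair of tori, `δ_β(L) = 1 − Z_β(L³ × 2L)/Z_β(L³ × L)²`,
which controls the thermal multiplicity `x_t = Z_β(L³ × t)/λ₊^t − 1` of Lüscher's transfer matrix of the spatial
torus `L³` only at the extents `t ∈ {L, 2L}` (and beyond), whereas the transfer-matrix bookkeeping of a connected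
time-correlation `⟨A; τ_n B⟩` of local observables of temporal width `w ≥ 1` at separations `n ≤ S` on the torus
`(2S+1)⁴` needs `x_t` of the spatial torus `(2S+1)³` at SHORTER extents `t < 2S + 1` (`t ≥ (S+1)/2` for the tree's
`abs_latticeConnectedCorr_le_of_coldPressure`; `t = 2S + 1 − 2w` for the optimal Hölder bookkeeping) — a cold-torus
free-energy bound that the two hypotheses do not supply (see the evidence note of the item).

This file PROVES the glue for the COLD defect `δ_β(L) = 1 − Z_β(L³ × 2⌊L/4⌋)/Z_β(L³ × ⌊L/4⌋)²` (temperature `4/L`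
against `2/L` in the volume `L³`), with binders, hypotheses and conclusion otherwise VERBATIM those of the item
(`recursionToGap_of_coldDefect`): the route's intended proof — iterate the recursion from an exit scale
(`defect_decay_of_recursion`: `−log δ` linear in the scale), read the defect spectrally
(`traceExcess_le_of_coldDefect_le`, `traceExcess_le_exp_of_le`: `Z = Tr 𝕋^t`, Lüscher positivity, over
`WilsonTorusTransferMatrix` / `WilsonFinTorusPartition`), and conclude by the transfer-matrix representation of torus
Wilson expectations with its finite-dimensional spectral bookkeeping (`uniformClustering_of_coldPressure`, crux
`WeakCouplingHypercubicLimit`).  References: M. Lüscher, Commun. Math. Phys. 54 (1977) 283; K. Osterwalder,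
E. Seiler, Ann. Phys. 110 (1978) 440, §§2–3; E. Seiler, LNP 159 (1982) Ch. 2.
-/

noncomputable section

open scoped BigOperators Topology
open MeasureTheory Filter
open Literature.MathematicalPhysics.QuantumFieldTheory
open Summit.QuantumFields.YangMills.Theorems.WeakCouplingHypercubicLimit.TraceNormColdPressure

namespace Summit.QuantumFields.YangMills.Theorems.DoublingDefect

/-- **The repaired glue `RecursionToGap` with the COLD period-doubling defect.**  Same binders, same two
hypotheses (doubling recursion, one-torus exit) and same conclusion (the `UniformLatticeGap` body for `(G, r)`)
as item `RecursionToGap` (stmt-QuantumFields-17755), but with the purity defect of the aspect-`(1, 2)` pair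
`δ_β(L) = 1 − Z_β(L³ × 2L)/Z_β(L³ × L)²` replaced by the defect of the COLD pair of shapes
`δ_β(L) = 1 − Z_β(L³ × 2⌊L/4⌋)/Z_β(L³ × ⌊L/4⌋)²` (temperature `4/L` against `2/L` in the spatial volume `L³`).
Proof: `Z` is `wilsonFinTorusPartition` by `rfl`; WLOG `C ≥ 2`; exit at `ε = 1/(16C)` beyond `max(L₀, 8)` and
`defect_decay_of_recursion` give `δ_β(L) ≤ C⁻¹ e^{−(L+1)/L_*}` for `L ≥ 2L_*` (non-negativity of the cold defect from
`Σ λ^{2t} ≤ (Σ λ^t)²`); at `P = 2S+1 ≥ 2L_*`, `traceExcess_le_of_coldDefect_le` turns this into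
`x_{⌊P/4⌋} ≤ e^{−(P+1)/L_*} ≤ e^{−(4/L_*)⌊P/4⌋}`, `traceExcess_le_exp_of_le` propagates it to every extent
`m + 2 ≥ (S+1)/2 ≥ ⌊P/4⌋`, which is the cold-pressure bound (rate `4/L_*`, constant `1 ≤ (2S+1)³`) consumed by
`uniformClustering_of_coldPressure` (the transfer-matrix representation of torus Wilson expectations and its
finite-dimensional spectral bookkeeping, crux `WeakCouplingHypercubicLimit`).  The group hypotheses are idle (the glue
is group-blind). [folklore] -/
theorem recursionToGap_of_coldDefect :
    ∀ (G : Type) [Group G] [TopologicalSpace G] [IsTopologicalGroup G] [CompactSpace G] [MeasurableSpace G] [BorelSpace G], Literature.MathematicalPhysics.QuantumFieldTheory.IsCompactSimpleLieGroup G → SimplyConnectedSpace G → ∀ r : Literature.MathematicalPhysics.QuantumFieldTheory.LatticeRep G, let Z : ℝ → ℕ → ℕ → ℝ := fun β a t => let St := Fin a × Fin a × Fin a × Fin t; let sh : St → Fin 4 → St := fun x μ => ![(finRotate a x.1, x.2.1, x.2.2.1, x.2.2.2), (x.1, finRotate a x.2.1, x.2.2.1, x.2.2.2), (x.1, x.2.1,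 finRotate a x.2.2.1, x.2.2.2), (x.1, x.2.1, x.2.2.1, finRotate t x.2.2.2)] μ; let pl : (St × Fin 4 → G) → St → Fin 4 → Fin 4 → G := fun U x μ ν => U (x, μ) * U (sh x μ, ν) * (U (sh x ν, μ))⁻¹ * (U (x, ν))⁻¹; ∫ U, Real.exp (-β * ∑ x : St, ∑ q : {q : Fin 4 × Fin 4 // q.1 < q.2}, ((r.N : ℝ) - (r.ρ (pl U x q.1.1 q.1.2)).trace.re)) ∂(Measure.pi fun _ : St × Fin 4 => Literature.MathematicalPhysics.QuantumFieldTheory.haarProbability G); let δ : ℝ → ℕ → ℝ := fun β L => 1 - Z β L (2 * (L / 4)) / (Z β L (L / 4)) ^ 2; (∃ C β₀ : ℝ, ∃ L₀ : ℕ, 0 < C ∧ ∀ β : ℝ, β₀ ≤ β → ∀ L : ℕ, L₀ ≤ L → ∀ L' : ℕ, 2 * L ≤ L' → L' ≤ 4 * L → δ β L' ≤ C * (δ β L) ^ 2) → (∀ ε : ℝ, 0 < ε → ∃ β₁ : ℝ, ∀ β : ℝ, β₁ ≤ β → ∀ L₀ : ℕ, ∃ L : ℕ, L₀ ≤ L ∧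 δ β L ≤ ε) → ∃ β₂ : ℝ, ∀ β : ℝ, β₂ ≤ β → ∃ m : ℝ, 0 < m ∧ ∃ S₁ : ℕ, ∀ A B : Literature.MathematicalPhysics.QuantumFieldTheory.YMSpecies G, ∃ C : ℝ, ∀ S n : ℕ, S₁ ≤ S → n ≤ S → |Literature.MathematicalPhysics.QuantumFieldTheory.latticeConnectedCorr r.ρ β (2 * S + 1) A.F B.F n| ≤ C * Real.exp (-(m * n)) := by
  intro G _ _ _ _ _ _ _hG _hSC r Z δ hR hE
  haveI : SecondCountableTopology G :=
    (r.continuous.isClosedEmbedding r.injective).isEmbedding.secondCountableTopology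
  have hδ : ∀ β L, δ β L = 1 - wilsonFinTorusPartition r.ρ β L L L (2 * (L / 4)) /
      wilsonFinTorusPartition r.ρ β L L L (L / 4) ^ 2 := fun _ _ => rfl
  obtain ⟨C, β₀, L₀, hC, hrec⟩ := hR
  -- WLOG `C ≥ 2`
  set C' : ℝ := max C 2 with hC'def
  have hC' : 0 < C' := lt_of_lt_of_le hC (le_max_left _ _)
  have hC'2 : 2 ≤ C' := le_max_right _ _
  have hrec' : ∀ β : ℝ, β₀ ≤ β → ∀ L : ℕ, L₀ ≤ L → ∀ L' : ℕ, 2 * L ≤ L' → L' ≤ 4 * L →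
      δ β L' ≤ C' * δ β L ^ 2 := fun β hβ L hL L' h2 h4 =>
    (hrec β hβ L hL L' h2 h4).trans (mul_le_mul_of_nonneg_right (le_max_left _ _) (sq_nonneg _))
  obtain ⟨β₁, hβ₁⟩ := hE (1 / (16 * C')) (by positivity)
  refine ⟨max β₀ (max β₁ 0), fun β hβ => ?_⟩
  have hββ₀ : β₀ ≤ β := le_trans (le_max_left _ _) hβ
  have hββ₁ : β₁ ≤ β := le_trans ((le_max_left _ _).trans (le_max_right _ _)) hβ
  have hβ0 : 0 ≤ β := le_trans ((le_max_right _ _).trans (le_max_right _ _)) hβ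
  -- the cold defect is non-negative at every scale `L ≥ 8`
  have hnn : ∀ L : ℕ, 8 ≤ L → 0 ≤ δ β L := fun L hL => by
    haveI : NeZero L := ⟨by omega⟩
    rw [hδ]
    exact coldDefect_nonneg r.continuous r.mem_unitary hβ0 L (L / 4) (by omega)
  -- one exit scale `L_* ≥ max(L₀, 8)` and the iteration
  obtain ⟨Ls, hLs, hex⟩ := hβ₁ β hββ₁ (max L₀ 8)
  have hLs8 : 8 ≤ Ls := le_trans (le_max_right _ _) hLs
  have hdec := defect_decay_of_recursion (δ := δ β) (L₀ := max L₀ 8) (Ls := Ls) hC'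
    (fun L hL L' h2 h4 => hrec' β hββ₀ L (le_trans (le_max_left _ _) hL) L' h2 h4)
    (fun L hL => hnn L (le_trans (le_max_right _ _) hL)) hLs (by omega) hex
  have hLsR : (0 : ℝ) < Ls := by exact_mod_cast (by omega : 0 < Ls)
  -- the cold-pressure bound at rate `4 / L_*`
  refine uniformClustering_of_coldPressure r hβ0 (g := 4 / Ls) (C₀ := 1) (by positivity) zero_le_one
    (S₁ := Ls) fun S hS m hm => ?_
  -- `P = 2S+1 ≥ 2 L_*`, `t₀ = ⌊P/4⌋ = m₀ + 2 ≥ 4`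
  obtain ⟨m₀, hm₀⟩ : ∃ m₀ : ℕ, (2 * S + 1) / 4 = m₀ + 2 := ⟨(2 * S + 1) / 4 - 2, by omega⟩
  have hm₀m : m₀ ≤ m := by omega
  have hP : 2 * Ls ≤ 2 * S + 1 := by omega
  -- `δ_β(P) ≤ C'⁻¹ e^{−(P+1)/L_*} ≤ 1/2`
  have hδP := hdec (2 * S + 1) hP
  have hexp1 : Real.exp (-((((2 * S + 1 : ℕ) : ℝ) + 1) / Ls)) ≤ 1 :=
    Real.exp_le_one_iff.2 (by
      have : (0 : ℝ) ≤ (((2 * S + 1 : ℕ) : ℝ) + 1) / Ls := by positivity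
      linarith)
  have hCinv : C'⁻¹ ≤ 1 / 2 := by rw [inv_eq_one_div]; exact one_div_le_one_div_of_le two_pos hC'2
  have hCinv0 : 0 ≤ C'⁻¹ := inv_nonneg.2 hC'.le
  have hδhalf : δ β (2 * S + 1) ≤ 1 / 2 :=
    hδP.trans ((mul_le_mul hCinv hexp1 (Real.exp_pos _).le (by norm_num)).trans (by norm_num))
  -- `x_{t₀} ≤ 2 δ_β(P)`
  have hδP' : 1 - wilsonFinTorusPartition r.ρ β (2 * S + 1) (2 * S + 1) (2 * S + 1) (2 * (m₀ + 2)) /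
      wilsonFinTorusPartition r.ρ β (2 * S + 1) (2 * S + 1) (2 * S + 1) (m₀ + 2) ^ 2 ≤ δ β (2 * S + 1) := by
    rw [hδ, hm₀]
  have hx₀ := traceExcess_le_of_coldDefect_le r.continuous r.mem_unitary hβ0 (2 * S + 1) m₀ hδhalf hδP'
  -- `2 δ_β(P) ≤ e^{−(P+1)/L_*} ≤ e^{−(4/L_*) t₀}`
  have h2δ : 2 * δ β (2 * S + 1) ≤ Real.exp (-(4 / Ls * ((m₀ + 2 : ℕ) : ℝ))) := by
    have h1 : 2 * δ β (2 * S + 1) ≤ Real.exp (-((((2 * S + 1 : ℕ) : ℝ) + 1) / Ls)) := by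
      have h := mul_le_mul_of_nonneg_left hδP zero_le_two
      refine h.trans ?_
      rw [← mul_assoc]
      have h2C : 2 * C'⁻¹ ≤ 1 := by linarith
      exact (mul_le_of_le_one_left (Real.exp_pos _).le h2C)
    refine h1.trans (Real.exp_le_exp.2 ?_)
    have ht₀ : 4 * ((m₀ + 2 : ℕ) : ℝ) ≤ ((2 * S + 1 : ℕ) : ℝ) + 1 := by
      have h : 4 * (m₀ + 2) ≤ 2 * S + 1 + 1 := by omega
      exact_mod_cast h
    rw [neg_le_neg_iff, div_mul_eq_mul_div, div_le_div_iff_of_pos_right hLsR]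
    exact ht₀
  have hx₀' : traceExcess r.ρ β (2 * S + 1) (m₀ + 2) ≤ Real.exp (-(4 / Ls * ((m₀ + 2 : ℕ) : ℝ))) :=
    hx₀.trans h2δ
  -- propagate to the extent `m + 2 ≥ t₀`
  have hxm := traceExcess_le_exp_of_le r.continuous r.mem_unitary hβ0 (2 * S + 1) hm₀m hx₀'
  refine hxm.trans ?_
  have hV : (1 : ℝ) ≤ 1 * ((2 * S + 1 : ℕ) : ℝ) ^ 3 := by
    rw [one_mul]
    exact one_le_pow₀ (by exact_mod_cast (by omega : 1 ≤ 2 * S + 1))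
  exact le_mul_of_one_le_left (Real.exp_pos _).le hV

end Summit.QuantumFields.YangMills.Theorems.DoublingDefect

end
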